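import Mathlib
import HarnessLib

/-!
# THE `k`-ARM HOMOGENEITY (COCHRAN) FUNCTIONAL OF A STANDARD GAUSSIAN VECTOR REDUCES TO
# `k − 1` SQUARES: `N^{⊗ι}{Σ_i z_i² − ⟨u, z⟩² ≤ c} = N^{⊗ι}{Σ_{r ≠ r₀} z_r² ≤ c}` FOR EVERY UNIT `u`

HONEST FRAMING: exact (Metropolis-corrected) sampling algorithms for lattice gauge theory;
figures of merit are autocorrelation/cost numbers at stated couplings and volumes; no
continuum-physics claim.

Venture `LatticeQCDFlow` (cell pub-lqcd), topic `Scoring`; FANOUT row 4 (`s0-u1-b`, GEN-33).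
NEW WORK of the cell (classical), no definition, nothing cited as a fact (Cochran's theorem / the
`χ²_{k−1}` homogeneity test are NAMED ONLY; Mathlib has no `χ²` law, so the reduced event
`{Σ_{r≠r₀} z_r² ≤ c}` under `N(0,1)^{⊗ι}` IS the definition-level "`P(χ²_{k−1} ≤ c)`").

WHY (row 4).  The cell compares MORE than two implementations of one sampler (S0 arms A, B, C;
"two implementations before 'reproduced'").  Pairwise `σ_comb` tests are calibrated in the tree; the
classical ONE-shot alternative is the inverse-variance homogeneity statistic
`Q = Σ_i (x_i − m̂)²/σ_i²`, `m̂ = (Σ_i x_i/σ_i²)/(Σ_i 1/σ_i²)`, whose large-sample null law — once the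
`k` studentised arm estimates are asymptotically independent `N(μ, σ_i²)` — is that of the
Gaussian functional `‖z‖² − ⟨u, z⟩²`, `u_i ∝ 1/σ_i`, `‖u‖ = 1`.  This Mathlib-level file proves the
exact reduction that makes that law free of `u` (hence of the unknown variances): a reflection
taking `u` to a coordinate vector `e_{r₀}` is a linear isometry, preserves `N(0,1)^{⊗ι}`
(`stdGaussian_map`, `map_pi_eq_stdGaussian`), and carries `‖z‖² − ⟨u,z⟩²` to `Σ_{r ≠ r₀} z_r²`.
The chain-level `k`-arm theorem (joint CLT of the arms, `Scoring/IndependentFamilyJointLimit`, then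
portmanteau) is NOT in this file.

## Content

* **`measurePreserving_euclidean_isometry_pi`** (§1) — for every linear isometry `O` of
  `EuclideanSpace ℝ ι`, `z ↦ ofLp (O (toLp z))` preserves `N(0,1)^{⊗ι}` (generalises the Helmert
  case of `Scoring/GaussianStudentEventReduction`).
* `reflection_unit_apply`, `reflection_unit_coord`, `sum_sq_erase_reflection_unit` (§2) — the
  reflection exchanging a unit vector `u` with `e_{r₀}`: `(O x)_{r₀} = ⟨x, u⟩`,
  `Σ_{r ≠ r₀} (O x)_r² = ‖x‖² − ⟨x, u⟩²`.
* **`pi_gaussianReal_cochran_eq_erase`** (§2) — `Σ_i u_i² = 1`: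
  `N^{⊗ι}{z | Σ_i z_i² − (Σ_i u_i z_i)² ≤ c} = N^{⊗ι}{z | Σ_{r ≠ r₀} z_r² ≤ c}`.
* `homogeneity_statistic_eq` (§3) — with `x_i = μ + σ_i z_i`:
  `Σ_i (x_i − m̂)²/σ_i² = Σ_i z_i² − (Σ_i z_i/σ_i)²/(Σ_i σ_i⁻²)`;
  **`pi_gaussianReal_homogeneity_eq_erase`** — `σ_i > 0`:
  `N^{⊗ι}{z | Σ_i ((μ + σ_i z_i) − m̂(z))²/σ_i² ≤ c} = N^{⊗ι}{z | Σ_{r ≠ r₀} z_r² ≤ c}`.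

Mathlib only.  [ours] throughout.
-/

open MeasureTheory ProbabilityTheory Filter Topology Finset

namespace Summit.Ventures.LatticeQCDFlow.Scoring

open Set WithLp
open scoped RealInnerProductSpace

/-! ## §1 Linear isometries of `EuclideanSpace ℝ ι`, read on `ι → ℝ`, preserve `N(0,1)^{⊗ι}` -/

section Isometry

variable {ι : Type*} [Fintype ι]

/-- **Every linear isometry of `EuclideanSpace ℝ ι`, read on `ι → ℝ`, preserves the product
Gaussian `N(0,1)^{⊗ι}`.** [ours] -/
theorem measurePreserving_euclidean_isometry_pi (O : EuclideanSpace ℝ ι ≃ₗᵢ[ℝ] EuclideanSpace ℝ ι) :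
    MeasurePreserving (fun z : ι → ℝ => ofLp (O (toLp 2 z)))
      (Measure.pi fun _ : ι => gaussianReal 0 1) (Measure.pi fun _ : ι => gaussianReal 0 1) := by
  have hmeas_toLp : Measurable (toLp 2 : (ι → ℝ) → EuclideanSpace ℝ ι) := by fun_prop
  have hmeas_ofLp : Measurable (ofLp : EuclideanSpace ℝ ι → (ι → ℝ)) := by fun_prop
  have hO_meas : Measurable (O : EuclideanSpace ℝ ι → EuclideanSpace ℝ ι) := O.continuous.measurable
  refine ⟨hmeas_ofLp.comp (hO_meas.comp hmeas_toLp), ?_⟩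
  have hcomp : (fun z : ι → ℝ => ofLp (O (toLp 2 z)))
      = (ofLp : EuclideanSpace ℝ ι → (ι → ℝ)) ∘ O ∘ (toLp 2) := rfl
  rw [hcomp, ← Measure.map_map hmeas_ofLp (hO_meas.comp hmeas_toLp),
    ← Measure.map_map hO_meas hmeas_toLp, map_pi_eq_stdGaussian, stdGaussian_map O,
    ← map_pi_eq_stdGaussian, Measure.map_map hmeas_ofLp hmeas_toLp]
  have hid : (ofLp : EuclideanSpace ℝ ι → (ι → ℝ)) ∘ (toLp 2) = id := funext fun z => rfl
  rw [hid, Measure.map_id]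

end Isometry

/-! ## §2 The reflection taking a unit vector to a coordinate vector; Cochran's reduction -/

section Cochran

variable {ι : Type*} [Fintype ι] [DecidableEq ι]

/-- The reflection in `(ℝ ∙ (u − e_{r₀}))ᗮ` maps the unit vector `u` to `e_{r₀}`. [ours] -/
theorem reflection_unit_apply (u : EuclideanSpace ℝ ι) (hu : ‖u‖ = 1) (r₀ : ι) :
    ((ℝ ∙ (u - EuclideanSpace.single r₀ (1 : ℝ)))ᗮ).reflection u = EuclideanSpace.single r₀ (1 : ℝ) := by
  apply Submodule.reflection_sub
  rw [hu, PiLp.norm_single, norm_one]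

/-- `(O x)_{r₀} = ⟨x, u⟩` for that reflection `O`. [ours] -/
theorem reflection_unit_coord (u : EuclideanSpace ℝ ι) (hu : ‖u‖ = 1) (r₀ : ι) (x : EuclideanSpace ℝ ι) :
    ((ℝ ∙ (u - EuclideanSpace.single r₀ (1 : ℝ)))ᗮ).reflection x r₀ = ⟪x, u⟫ := by
  set O := ((ℝ ∙ (u - EuclideanSpace.single r₀ (1 : ℝ)))ᗮ).reflection with hO
  have h1 : O x r₀ = ⟪O x, EuclideanSpace.single r₀ (1 : ℝ)⟫ := by
    rw [EuclideanSpace.inner_single_right]; simp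
  rw [h1, ← reflection_unit_apply u hu r₀, ← hO, LinearIsometryEquiv.inner_map_map]

/-- `Σ_{r ≠ r₀} (O x)_r² = ‖x‖² − ⟨x, u⟩²`. [ours] -/
theorem sum_sq_erase_reflection_unit (u : EuclideanSpace ℝ ι) (hu : ‖u‖ = 1) (r₀ : ι)
    (x : EuclideanSpace ℝ ι) :
    ∑ r ∈ univ.erase r₀, (((ℝ ∙ (u - EuclideanSpace.single r₀ (1 : ℝ)))ᗮ).reflection x) r ^ 2
      = ‖x‖ ^ 2 - ⟪x, u⟫ ^ 2 := by
  set O := ((ℝ ∙ (u - EuclideanSpace.single r₀ (1 : ℝ)))ᗮ).reflection with hO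
  have hnorm : ∑ r, (O x) r ^ 2 = ‖x‖ ^ 2 := by
    rw [← EuclideanSpace.real_norm_sq_eq, LinearIsometryEquiv.norm_map]
  rw [Finset.sum_erase_eq_sub (Finset.mem_univ _), hnorm, hO, reflection_unit_coord u hu r₀ x]

omit [DecidableEq ι] in
/-- `⟨toLp z, toLp u⟩ = Σ_i u_i z_i` and `‖toLp z‖² = Σ_i z_i²` on `ι → ℝ`. -/
theorem inner_toLp_toLp_eq_sum (z u : ι → ℝ) :
    ⟪(toLp 2 z : EuclideanSpace ℝ ι), (toLp 2 u : EuclideanSpace ℝ ι)⟫ = ∑ i, u i * z i := by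
  rw [PiLp.inner_apply]
  simp only [RCLike.inner_apply, conj_trivial]

/-- **COCHRAN'S REDUCTION**: for every `u : ι → ℝ` with `Σ_i u_i² = 1`, every `r₀` and every `c`,
`N(0,1)^{⊗ι}{z | Σ_i z_i² − (Σ_i u_i z_i)² ≤ c} = N(0,1)^{⊗ι}{z | Σ_{r ≠ r₀} z_r² ≤ c}` — the law of
the Cochran functional does not depend on the unit vector (textbook: `χ²_{k−1}`, `k = card ι`). [ours] -/
theorem pi_gaussianReal_cochran_eq_erase (u : ι → ℝ) (hu : ∑ i, u i ^ 2 = 1) (r₀ : ι) (c : ℝ) :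
    (Measure.pi fun _ : ι => gaussianReal 0 1)
        {z : ι → ℝ | ∑ i, z i ^ 2 - (∑ i, u i * z i) ^ 2 ≤ c}
      = (Measure.pi fun _ : ι => gaussianReal 0 1) {z : ι → ℝ | ∑ r ∈ univ.erase r₀, z r ^ 2 ≤ c} := by
  set uE : EuclideanSpace ℝ ι := toLp 2 u with huE
  have hnu : ‖uE‖ = 1 := by
    have h2 : ‖uE‖ ^ 2 = 1 := by
      rw [EuclideanSpace.real_norm_sq_eq]
      simpa [huE] using hu
    have h0 : 0 ≤ ‖uE‖ := norm_nonneg _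
    nlinarith [h2, h0]
  set O := ((ℝ ∙ (uE - EuclideanSpace.single r₀ (1 : ℝ)))ᗮ).reflection with hO
  have hmp := measurePreserving_euclidean_isometry_pi (ι := ι) O
  have hBm : MeasurableSet {z : ι → ℝ | ∑ r ∈ univ.erase r₀, z r ^ 2 ≤ c} :=
    measurableSet_le (by fun_prop) measurable_const
  have hpre : {z : ι → ℝ | ∑ i, z i ^ 2 - (∑ i, u i * z i) ^ 2 ≤ c}
      = (fun z : ι → ℝ => ofLp (O (toLp 2 z))) ⁻¹' {z : ι → ℝ | ∑ r ∈ univ.erase r₀, z r ^ 2 ≤ c} := by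
    ext z
    simp only [Set.mem_setOf_eq, Set.mem_preimage]
    have h := sum_sq_erase_reflection_unit uE hnu r₀ (toLp 2 z)
    rw [← hO] at h
    have h' : ∑ r ∈ univ.erase r₀, (ofLp (O (toLp 2 z))) r ^ 2 = ‖(toLp 2 z : EuclideanSpace ℝ ι)‖ ^ 2
        - ⟪(toLp 2 z : EuclideanSpace ℝ ι), uE⟫ ^ 2 := by
      simpa using h
    rw [h', EuclideanSpace.real_norm_sq_eq, huE, inner_toLp_toLp_eq_sum]
  rw [hpre, ← Measure.map_apply hmp.measurable hBm, hmp.map_eq]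

end Cochran

/-! ## §3 The inverse-variance homogeneity statistic in standardised coordinates -/

section Homogeneity

variable {ι : Type*} [Fintype ι] [DecidableEq ι]

omit [DecidableEq ι] in
/-- **The homogeneity statistic in standardised coordinates**: with `x_i = μ + σ_i z_i`,
`W = Σ_i σ_i⁻²`, `m̂ = (Σ_i x_i/σ_i²)/W`:  `Σ_i (x_i − m̂)²/σ_i² = Σ_i z_i² − (Σ_i z_i/σ_i)²/W`
(`σ_i ≠ 0`, `W ≠ 0`). [ours] -/
theorem homogeneity_statistic_eq (μ : ℝ) (σ z : ι → ℝ) (hσ : ∀ i, σ i ≠ 0)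
    (hW : ∑ i, (σ i ^ 2)⁻¹ ≠ 0) :
    ∑ i, ((μ + σ i * z i) - (∑ j, (μ + σ j * z j) / σ j ^ 2) / (∑ j, (σ j ^ 2)⁻¹)) ^ 2 / σ i ^ 2
      = ∑ i, z i ^ 2 - (∑ i, z i / σ i) ^ 2 / ∑ i, (σ i ^ 2)⁻¹ := by
  set W := ∑ i, (σ i ^ 2)⁻¹ with hWdef
  set S := ∑ i, z i / σ i with hS
  have hsum1 : ∑ j, (μ + σ j * z j) / σ j ^ 2 = μ * W + S := by
    rw [hWdef, hS, Finset.mul_sum, ← Finset.sum_add_distrib]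
    refine Finset.sum_congr rfl fun j _ => ?_
    field_simp [hσ j]
  rw [hsum1]
  have hm : (μ * W + S) / W = μ + S / W := by field_simp
  rw [hm]
  have hterm : ∀ i, ((μ + σ i * z i) - (μ + S / W)) ^ 2 / σ i ^ 2
      = z i ^ 2 - 2 * (z i / σ i) * (S / W) + (σ i ^ 2)⁻¹ * (S / W) ^ 2 := fun i => by
    field_simp [hσ i]
    ring
  simp_rw [hterm, Finset.sum_add_distrib, Finset.sum_sub_distrib, ← Finset.sum_mul, ← Finset.mul_sum]
  rw [← hS, ← hWdef]
  field_simp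
  ring

/-- **THE `k`-ARM HOMOGENEITY FUNCTIONAL OF INDEPENDENT STANDARD NORMALS REDUCES TO `k − 1`
SQUARES**: for `σ_i > 0`, every `μ`, `r₀`, `c`,
`N(0,1)^{⊗ι}{z | Σ_i ((μ + σ_i z_i) − m̂(z))²/σ_i² ≤ c} = N(0,1)^{⊗ι}{z | Σ_{r ≠ r₀} z_r² ≤ c}`
— the asymptotic null law of the inverse-variance homogeneity statistic of `k` arm estimates with
(asymptotic) standard errors `σ_i` is the same for all `σ`, `μ` (textbook: `χ²_{k−1}`). [ours] -/
theorem pi_gaussianReal_homogeneity_eq_erase (μ : ℝ) (σ : ι → ℝ) (hσ : ∀ i, 0 < σ i) (r₀ : ι) (c : ℝ) :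
    (Measure.pi fun _ : ι => gaussianReal 0 1)
        {z : ι → ℝ | ∑ i, ((μ + σ i * z i) - (∑ j, (μ + σ j * z j) / σ j ^ 2) / (∑ j, (σ j ^ 2)⁻¹)) ^ 2
          / σ i ^ 2 ≤ c}
      = (Measure.pi fun _ : ι => gaussianReal 0 1) {z : ι → ℝ | ∑ r ∈ univ.erase r₀, z r ^ 2 ≤ c} := by
  have hne : Nonempty ι := ⟨r₀⟩
  set W := ∑ i, (σ i ^ 2)⁻¹ with hWdef
  have hW : 0 < W := Finset.sum_pos (fun i _ => by have := hσ i; positivity) Finset.univ_nonempty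
  set u : ι → ℝ := fun i => (σ i)⁻¹ / Real.sqrt W with hu
  have hu1 : ∑ i, u i ^ 2 = 1 := by
    simp only [hu, div_pow, inv_pow, Real.sq_sqrt hW.le]
    rw [← Finset.sum_div, ← hWdef, div_self hW.ne']
  have hset : {z : ι → ℝ | ∑ i, ((μ + σ i * z i) - (∑ j, (μ + σ j * z j) / σ j ^ 2) / (∑ j, (σ j ^ 2)⁻¹)) ^ 2
          / σ i ^ 2 ≤ c} = {z : ι → ℝ | ∑ i, z i ^ 2 - (∑ i, u i * z i) ^ 2 ≤ c} := by
    ext z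
    simp only [Set.mem_setOf_eq]
    rw [homogeneity_statistic_eq μ σ z (fun i => (hσ i).ne') hW.ne']
    have hS : (∑ i, u i * z i) ^ 2 = (∑ i, z i / σ i) ^ 2 / W := by
      have : ∑ i, u i * z i = (∑ i, z i / σ i) / Real.sqrt W := by
        rw [Finset.sum_div]
        refine Finset.sum_congr rfl fun i _ => ?_
        simp only [hu]
        field_simp
      rw [this, div_pow, Real.sq_sqrt hW.le]
    rw [hS]
  rw [hset]
  exact pi_gaussianReal_cochran_eq_erase u hu1 r₀ c

end Homogeneity

end Summit.Ventures.LatticeQCDFlow.Scoring
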